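import Literature.IUT.LogVolume.GenuineLogThetaPoint
import Literature.IUT.LogVolume.Theorem110TowerArith
import Literature.IUT.LogVolume.DistinguishedPrimesBoundGalois
import Literature.IUT.LogVolume.LambdaLineGalois
import HarnessLib

/-!
# [IUTchIV] Thm. 1.10 Step (iii) AT A GENUINE Θ-VOLUME DATUM: `log(𝔰^ℚ) ≤ 2·d_mod·(log(𝔡^{F_tpd}) +
# log(𝔣^{F_tpd})) + log(2·3·5·l)` for the support primes of the datum (S-b, the `(iii)` instance)

Mochizuki, *Inter-universal Teichmüller theory IV*, RIMS manuscript (Apr. 2020; = PRIMS **57** (2021)), Thm. 1.10 proof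
Step (iii), pp. 25–26: "`𝕍^dst` … the set of 'distinguished' nonarchimedean valuations `v ∈ 𝕍(F□)^non`, i.e., `v` that
extend to a valuation `∈ 𝕍(K)^non` that ramifies over `ℚ`"; "(D0) if `v ∈ 𝕍(F_tpd)^non` does not divide `2·3·5·l` and,
moreover, is not contained in `Supp(𝔮^{F_tpd}_ADiv)`, then the extension `K/F_tpd` is unramified over `v`"; "(D5) The
valuation `v_ℚ` ramifies in `K`. (D6) Either `p_{v_ℚ} | 2·3·5·l` or `v_ℚ` lies in the image of `Supp(𝔮^{F_tpd}_ADiv +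
𝔡^{F_tpd}_ADiv)`"; "`log(𝔰^ℚ) ≤ 2·d_mod·(log(𝔡^{F_tpd}) + log(𝔣^{F_tpd})) + log(2·3·5·l)`" (p. 26). TAKES NO SIDE on
[IUTchIII] Cor. 3.12.

For a genuine Θ-volume datum `T` at a point `P = (F_tpd, λ)` of the `λ`-line and a prime `l` (abc-iut-S2/w4-d037's
`Cor22.ThetaVolumeDatumAt P l`), the nonarchimedean `−|log(Θ)|` and abc-iut-c312-d1's Step (v) constant `δ_K(T)` are
sums over the SUPPORT PRIMES `T(I) = {prime factors of 2·|disc K|} ∪ {residue characteristics of 𝕍^bad_mod}`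
(`ThetaVolumeInput.supportPrimes`), whose `log(𝔰^ℚ)`-term is `Σ_{q ∈ T(I)} log q`. THIS FILE proves the Step (iii)
bound for it — the input `B ≤ …` of abc-iut-S3's `Cor22.ThetaVolumeDatumAt.hullEstimateOf_BIII_of_bounds`:

* `Cor22.ThetaVolumeDatumAt.sum_log_supportPrimes_le` — `Σ_{q ∈ T(I)} log q ≤ 2·d_mod·(log-diff(λ) + log 𝔣^{∤{2,l}}(λ))
  + log(2·3·5·l)`, from abc-iut-L5-t15's `sum_log_distinguished_le` over the Galois layer `F_mod = ℚ(j(λ)) ⊆ F_tpd`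
  (abc-iut-S3 g2 `isGalois_adjoin_jInv`), GIVEN the (D0)-descent of ramified places of `K` prime to `2·3·5·l` to bad or
  ramified places of `F_tpd` in the OUTPUT shape of L5-t15's `ramified_place_descends_of_not_dvd` (hypothesis `hD0`;
  its inputs are [IUTchIV] Prop. 1.8 (vi)(vii) instance forms for `F_tpd ⊆ F ⊆ K`, abc-iut-S-d1). The two kinds of
  support primes are treated separately: a prime factor `q ∤ 2·3·5·l` of `disc K` has a ramified place of `K` above
  it (Mathlib `NumberField.not_dvd_discr_iff_forall_mem`), which descends by `hD0`; the residue characteristic of a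
  bad prime `u ∈ 𝕍^bad_mod` lies under a place `x` of `F` of multiplicative reduction not dividing `2l` (the (P5)
  choice, `ThetaData.IsP5Choice`), hence — `ord_x(j(E_F)) < 0`, `j(E_F) = j(λ)` — under a bad place of `F_tpd` away
  from `{2, l}`: NO Kummer/Tate ramification statement at the bad places is needed.
* bookkeeping over a tower `F ⊆ K`: `ord_algebraMap_neg_iff` (the sign of `ord` descends/ascends along `finBelow`),
  `natCast_mem_asIdeal_finBelow_iff`, `exists_ramified_place_of_dvd_discr`, and the saturation of `badPlacesAvoid P S` over
  `F_mod` (`mem_badPlacesAvoid_of_finBelow_eq`).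

[cite: Mochizuki2012, IUTchIV Thm. 1.10 proof Step (iii) p. 25–26] [claim: Mochizuki2012, status: disputed] for every
IUT quotation. Classical algebraic number theory; nothing here asserts anything about Cor. 3.12, and the (D0) input is
a hypothesis.
-/

noncomputable section

namespace Literature.IUT.LogVolume

namespace Cor22

open NumberField IsDedekindDomain Literature.IUT.HodgeTheaters
open Literature.NumberTheory.DiophantineGeometry.GenEll

/-! ## Bookkeeping along a tower `F ⊆ K` -/

section Tower

variable {F K : Type} [Field F] [NumberField F] [Field K] [NumberField K] [Algebra F K]

/-- `ord_w(y) = e(w|v)·ord_v(y)` for `w | v` and `y ∈ F` (Mathlib `valuation_liesOver`).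
[cite: NeukirchANT1999, Ch. II (8.?) / Ch. I (8.2)] -/
theorem ord_algebraMap_eq (w : HeightOneSpectrum (𝓞 K)) (y : F) :
    ord K w (algebraMap F K y) =
      ((finBelow F K w).asIdeal.ramificationIdx' w.asIdeal : ℤ) * ord F (finBelow F K w) y := by
  unfold ord
  rw [← IsDedekindDomain.HeightOneSpectrum.valuation_liesOver K (finBelow F K w) w y, WithZero.log_pow]
  ring

/-- The sign of `ord` is the same above and below: `ord_w(y) < 0 ↔ ord_v(y) < 0` for `w | v`, `y ∈ F`.
[cite: NeukirchANT1999, Ch. I (8.2)] -/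
theorem ord_algebraMap_neg_iff (w : HeightOneSpectrum (𝓞 K)) (y : F) :
    ord K w (algebraMap F K y) < 0 ↔ ord F (finBelow F K w) y < 0 := by
  rw [ord_algebraMap_eq w y]
  have he : (0 : ℤ) < ((finBelow F K w).asIdeal.ramificationIdx' w.asIdeal : ℤ) := by
    exact_mod_cast Nat.pos_of_ne_zero
      (Ideal.IsDedekindDomain.ramificationIdx'_ne_zero_of_liesOver w.asIdeal (finBelow F K w).ne_bot)
  constructor
  · intro h
    by_contra hge
    exact absurd h (not_lt.mpr (mul_nonneg he.le (not_lt.mp hge)))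
  · intro h
    exact mul_neg_of_pos_of_neg he h

omit [NumberField F] [NumberField K] in
/-- A rational integer lies in `w` iff it lies in the place below `w`. [cite: NeukirchANT1999, Ch. I (8.2)] -/
theorem natCast_mem_asIdeal_finBelow_iff (w : HeightOneSpectrum (𝓞 K)) (n : ℕ) :
    (n : 𝓞 F) ∈ (finBelow F K w).asIdeal ↔ (n : 𝓞 K) ∈ w.asIdeal := by
  change algebraMap (𝓞 F) (𝓞 K) (n : 𝓞 F) ∈ w.asIdeal ↔ _
  rw [map_natCast]

end Tower

/-- **A prime dividing the discriminant has a ramified place above it** ((D5): "the valuation `v_ℚ` ramifies in `K`";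
Mathlib's `NumberField.not_dvd_discr_iff_forall_mem` + `Ideal.ramificationIdx_eq_one_iff`).
[cite: NeukirchANT1999, Ch. III (2.12)] -/
theorem exists_ramified_place_of_dvd_discr (K : Type) [Field K] [NumberField K] {q : ℕ} (hq : q.Prime)
    (h : (q : ℤ) ∣ NumberField.discr K) :
    ∃ u : HeightOneSpectrum (𝓞 K), residueChar K u = q ∧ 2 ≤ u.asIdeal.ramificationIdx ℤ := by
  have hp : Prime (q : ℤ) := Nat.prime_iff_prime_int.mp hq
  have hB : ¬ ∀ (Q : Ideal (𝓞 K)) (_ : Q.IsPrime), ((q : ℤ) : 𝓞 K) ∈ Q → Algebra.IsUnramifiedAt ℤ Q :=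
    fun hB => (NumberField.not_dvd_discr_iff_forall_mem K (𝓞 K) hp).mpr hB h
  push Not at hB
  obtain ⟨Q, hQ, hqQ, hnot⟩ := hB
  have hQne : Q ≠ ⊥ := by
    intro hbot
    rw [hbot, Ideal.mem_bot, Int.cast_natCast, Nat.cast_eq_zero] at hqQ
    exact hq.ne_zero hqQ
  let u : HeightOneSpectrum (𝓞 K) := ⟨Q, hQ, hQne⟩
  haveI : Q.IsMaximal := hQ.isMaximal hQne
  have hunder : Q.under ℤ = Ideal.span {(q : ℤ)} :=
    (((Ideal.liesOver_span_iff hQ.ne_top hp).mpr hqQ).1).symm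
  refine ⟨u, ?_, ?_⟩
  · show Ideal.absNorm (Q.under ℤ) = q
    rw [hunder, Ideal.absNorm_span_singleton]
    simp
  · have h1 : 1 ≤ Q.ramificationIdx ℤ := Ideal.ramificationIdx_pos Q ℤ
    have hne : Q.ramificationIdx ℤ ≠ 1 := fun h1' => hnot (Ideal.ramificationIdx_eq_one_iff.mp h1')
    show 2 ≤ Q.ramificationIdx ℤ
    omega

/-! ## The saturation of `𝕍(F_tpd)^bad` over `F_mod = ℚ(j(λ))` -/

section Point

variable (P : NFPoint) (S : Finset ℕ)

/-- Membership in `badPlacesAvoid P S` depends only on the place of `F_mod = ℚ(j(λ))` below: if two places of `F_tpd` lie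
over the same place of `ℚ(j(λ))` and one is bad away from `S`, so is the other (`ord_w j(λ) < 0` is read below, where
`j(λ)` lives; `p ∈ w` is read below). [cite: Mochizuki2012, IUTchIV Thm. 1.10 p. 23] -/
theorem mem_badPlacesAvoid_of_finBelow_eq {w w' : HeightOneSpectrum (𝓞 P.F)}
    (h : finBelow (IntermediateField.adjoin ℚ ({jInv P.x} : Set P.F)) P.F w =
      finBelow (IntermediateField.adjoin ℚ ({jInv P.x} : Set P.F)) P.F w')
    (hw' : w' ∈ badPlacesAvoid P S) : w ∈ badPlacesAvoid P S := by
  classical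
  set Fmod := IntermediateField.adjoin ℚ ({jInv P.x} : Set P.F)
  let jm : Fmod := ⟨jInv P.x, IntermediateField.mem_adjoin_simple_self ℚ _⟩
  unfold badPlacesAvoid at hw' ⊢
  rw [Finset.mem_filter] at hw' ⊢
  obtain ⟨hbad', hS'⟩ := hw'
  constructor
  · rw [mem_badPlaces_iff_ord_neg] at hbad' ⊢
    change ord P.F w' (algebraMap Fmod P.F jm) < 0 at hbad'
    change ord P.F w (algebraMap Fmod P.F jm) < 0
    rw [ord_algebraMap_neg_iff] at hbad' ⊢
    rwa [h]
  · intro p hp hmem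
    exact hS' p hp ((natCast_mem_asIdeal_finBelow_iff (F := Fmod) w' p).mp
      (h ▸ (natCast_mem_asIdeal_finBelow_iff (F := Fmod) w p).mpr hmem))

end Point

/-! ## At the datum -/

namespace ThetaVolumeDatumAt

variable {P : NFPoint} {l : ℕ} (T : ThetaVolumeDatumAt P l)

/-- **[IUTchIV] Thm. 1.10 Step (iii) for the support primes of a genuine Θ-volume datum.** For a genuine datum `T` at
`(P, l)` (`λ ∈ U_X` minimally presented, `l ≥ 1`), ASSUMING the (D0)-descent `hD0` — every place `u` of `K` ramified over `ℚ` with residue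
characteristic prime to `2·3·5·l` lies over a place of `F_tpd` that is bad away from `{2, l}` or itself ramified over `ℚ`
(the output of abc-iut-L5-t15's `ramified_place_descends_of_not_dvd`, whose inputs are the Prop. 1.8 (vi)(vii) instance
forms for `F_tpd ⊆ F ⊆ K`) —: `Σ_{q ∈ T(I)} log q ≤ 2·d_mod·(log-diff(λ) + log 𝔣^{∤{2,l}}(λ)) + log(2·3·5·l)`.
[cite: Mochizuki2012, IUTchIV Thm. 1.10 proof Step (iii) p. 25–26] [claim: Mochizuki2012, status: disputed] -/
theorem sum_log_supportPrimes_le (hP : P ∈ UP) (hl : 0 < l)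
    (hD0 : letI := T.instFieldF; letI := T.instNumberFieldF; letI := T.instAlgebraF; letI := T.instFieldK
      letI := T.instNumberFieldK; letI := T.instAlgebraK
      ∀ u : HeightOneSpectrum (𝓞 T.K), 2 ≤ u.asIdeal.ramificationIdx ℤ → ¬ residueChar T.K u ∣ 2 * 3 * 5 * l →
        finBelow P.F T.F (finBelow T.F T.K u) ∈ badPlacesAvoid P {2, l} ∨
          2 ≤ (finBelow P.F T.F (finBelow T.F T.K u)).asIdeal.ramificationIdx ℤ) :
    (letI := T.instFieldF; letI := T.instNumberFieldF; letI := T.instFieldK; letI := T.instNumberFieldK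
     letI := T.instAlgebraK
     ∑ q ∈ T.I.supportPrimes, Real.log (q : ℝ)) ≤
      2 * (dmod P : ℝ) * (P.logDiff + logCondAvoid P {2, l}) + Real.log (2 * 3 * 5 * (l : ℝ)) := by
  classical
  letI := T.instFieldF; letI := T.instNumberFieldF; letI := T.instAlgebraF; letI := T.instFieldK
  letI := T.instNumberFieldK; letI := T.instAlgebraK; letI := T.instFieldFbar; letI := T.instAlgebraFbar
  letI := T.instAlgebraKFbar; letI := T.instIsElliptic
  -- the Galois layer `F_mod = ℚ(j(λ)) ⊆ F_tpd`
  set Fmod := IntermediateField.adjoin ℚ ({jInv P.x} : Set P.F) with hFmod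
  haveI : NumberField Fmod := NumberField.mk
  haveI : IsGalois Fmod P.F := isGalois_adjoin_jInv P hP
  -- bad places of `F_tpd` away from `{2, l}` and their images in `F_mod`
  set T₀ := badPlacesAvoid P {2, l} with hT₀
  set S := T₀.image (finBelow Fmod P.F) with hS
  have hT : ∀ w, w ∈ T₀ ↔ finBelow Fmod P.F w ∈ S := by
    intro w
    refine ⟨fun hw => Finset.mem_image_of_mem _ hw, fun hw => ?_⟩
    obtain ⟨w', hw', hww'⟩ := Finset.mem_image.mp hw
    exact mem_badPlacesAvoid_of_finBelow_eq P {2, l} hww'.symm hw'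
  -- the right-hand side in the tower lemma's currency
  have hrhs : 2 * (Module.finrank ℚ Fmod : ℝ) *
      (ndeg P.F (differentDivisor P.F) + ndeg P.F (ADivisor.reduced T₀)) + Real.log (2 * 3 * 5 * (l : ℝ)) =
      2 * (dmod P : ℝ) * (P.logDiff + logCondAvoid P {2, l}) + Real.log (2 * 3 * 5 * (l : ℝ)) := by
    rw [logDiff_add_logCondAvoid_eq_ndeg]
    rfl
  rw [← hrhs]
  refine sum_log_distinguished_le Fmod P.F S T₀ hT hl T.I.supportPrimes
    (fun q hq => T.I.prime_of_mem_supportPrimes hq) fun q hq => ?_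
  have hqprime : q.Prime := T.I.prime_of_mem_supportPrimes hq
  by_cases hdvd : q ∣ 2 * 3 * 5 * l
  · exact Or.inl hdvd
  right
  -- the two kinds of support primes
  have hq' := hq
  unfold ThetaVolumeInput.supportPrimes at hq'
  rcases Finset.mem_union.mp hq' with hdisc | hbad
  · -- `q | 2·disc K`, `q ∤ 30l` (so `q ≠ 2`): a ramified place of `K` above `q`, descended by (D0)
    have hq2 : q ≠ 2 := by rintro rfl; exact hdvd ⟨3 * 5 * l, by ring⟩
    have hqK : (q : ℤ) ∣ NumberField.discr T.K := by
      have h1 : q ∣ 2 * (NumberField.discr T.K).natAbs := Nat.dvd_of_mem_primeFactors hdisc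
      have h2 : q ∣ (NumberField.discr T.K).natAbs := by
        rcases (Nat.Prime.dvd_mul hqprime).mp h1 with h | h
        · exact absurd ((Nat.prime_dvd_prime_iff_eq hqprime Nat.prime_two).mp h) hq2
        · exact h
      exact Int.ofNat_dvd_left.mpr h2
    obtain ⟨u, huq, hu2⟩ := exists_ramified_place_of_dvd_discr T.K hqprime hqK
    have hndvd : ¬ residueChar T.K u ∣ 2 * 3 * 5 * l := by rwa [huq]
    set x := finBelow T.F T.K u with hx
    set w := finBelow P.F T.F x with hw
    have hwq : residueChar P.F w = q := by
      rw [hw, residueChar_finBelow, hx, residueChar_finBelow, huq]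
    refine ⟨finBelow Fmod P.F w, by rw [residueChar_finBelow, hwq], ?_⟩
    rcases hD0 u hu2 hndvd with hwbad | hwram
    · exact Or.inl ((hT w).mp hwbad)
    · refine Or.inr fun w' hw' => ?_
      rw [ramificationIdx_int_eq_of_finBelow_eq w' w hw']
      exact hwram
  · -- `q` = residue characteristic of a bad prime `v ∈ 𝕍^bad_mod` of `F_mod(E_F)`: under a bad place of `F_tpd`
    obtain ⟨v, hv, hvq⟩ := Finset.mem_image.mp hbad
    have hvS : v ∈ (ThetaData.pilotData T.D).S := by rw [← T.isVolumeInputOf.X_eq]; exact hv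
    rw [ThetaData.pilotData_S] at hvS
    -- a place `x` of `F` over `v`: multiplicative reduction, not over `2`, `l`
    obtain ⟨x, hxv⟩ := PlaceSection.exists_under_eq (F₀ := fieldOfModuli T.E) (K := T.F) v
    have hmult : T.E.HasMultiplicativeReductionAt x := ThetaData.hasMultiplicativeReductionAt_of_under T.D hvS hxv
    have hVF : FinitePlace.mk x ∈ T.D.VFbad := ThetaData.mk_mem_VFbad_of_under T.D hvS hxv
    have hP5 := (T.isP5Choice (FinitePlace.mk x)).mp hVF
    rw [FinitePlace.maximalIdeal_mk] at hP5
    have hordx : ord T.F x T.E.j < 0 := ThetaData.ord_j_neg_of_hasMultiplicativeReductionAt hmult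
    rw [T.j_eq] at hordx
    -- the place `w` of `F_tpd` under `x` is bad away from `{2, l}`
    set w := finBelow P.F T.F x with hw
    have hwbad : w ∈ T₀ := by
      rw [hT₀]
      unfold badPlacesAvoid
      rw [Finset.mem_filter, mem_badPlaces_iff_ord_neg]
      refine ⟨(ord_algebraMap_neg_iff x (jInv P.x)).mp hordx, fun p hp hmem => ?_⟩
      exact hP5.1 p hp ((natCast_mem_asIdeal_finBelow_iff (F := P.F) x p).mp hmem)
    -- residue characteristics agree along `v | x | w`
    have hxq : residueChar T.F x = q := by
      have hfin : finBelow (fieldOfModuli T.E) T.F x = v :=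
        HeightOneSpectrum.ext (by rw [← hxv]; rfl)
      rw [← residueChar_finBelow (F := fieldOfModuli T.E), hfin, hvq]
    have hwq : residueChar P.F w = q := by rw [hw, residueChar_finBelow, hxq]
    exact ⟨finBelow Fmod P.F w, by rw [residueChar_finBelow, hwq], Or.inl ((hT w).mp hwbad)⟩

end ThetaVolumeDatumAt

end Cor22

end Literature.IUT.LogVolume

end
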